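import Summits.Ventures.CertifiedArithmetic.LowPrec.EnvelopeStructural
import Mathlib.Data.Nat.Prime.Basic
import Mathlib.Tactic.NormNum.Prime

/-!
# When is the sharp relative error `u/(1+u)` attained? (Corollary E1-attain)

HONEST FRAMING (venture CertifiedArithmetic / cell `pub-lowprec`): certified error envelopes and
provably optimal rounding/accumulation schemes for low-precision formats under stated cost models;
every table by two implementations; no hardware or vendor claims.

`abs_sub_roundNE_le_sharp` (EnvelopeStructural.lean) bounds the normal-range relative error of
round-to-nearest by `u/(1+u)`. Here: (1) equality forces `|x| = (1+u)·2^(m+s)·quantum`, the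
midpoint just above the power of two opening the binade of `x` (`abs_eq_sharp_imp`), i.e.
`|x| = (2^p + 1)·2^(s-1)·quantum` with `p = m+1`; (2) consequently, for PRODUCTS of two data of
the same format, attainment requires the odd prime-or-not number `2^p + 1` to divide the product
of the two integral significands, which is impossible when `2^p + 1` is prime since both
significands are `< 2^p` (`abs_errMul_lt_sharp_of_prime`); (3) instances: `2^2+1 = 5`,
`2^4+1 = 17`, `2^8+1 = 257` are prime, so the self-format product tables of `E2M1` (p = 2),
`E4M3`/`E2M3` (p = 4) and `bfloat16` (p = 8) NEVER attain `u/(1+u)` in the normal range — the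
classical criterion of [JeannerodRump2018, Thm 3.2] ("optimal iff `2^p+1` is not prime"),
here for the cell's formats; `p = 3` (`9 = 3·3`: E5M2, E3M2) and `p = 11` (`2049 = 3·683`:
binary16) can attain (witness for E3M2 in EnvelopesE3M2.lean).
-/

namespace Literature.ComputerArithmetic.FloatingPoint

namespace MiniFloat

open Format

variable {φ : Format}

/-- EQUALITY CASE of the sharp bound: in the normal range, `|x - fl x| = u/(1+u)·|x|` forces
`|x| = (1 + u) · 2^(m+s) · quantum` where `s` is the spacing exponent of the binade of `|x|`.
[folklore] -/
theorem abs_eq_sharp_imp {x : ℚ} (hlo : 2 ^ φ.manBits * φ.quantum ≤ |x|) (hhi : |x| ≤ φ.maxRat)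
    (heq : |x - (roundNE φ x).toRat| = φ.unitRoundoff / (1 + φ.unitRoundoff) * |x|) :
    |x| = (1 + φ.unitRoundoff) *
      ((2 : ℚ) ^ (φ.manBits + φ.shift ⌊|x| / φ.quantum⌋.toNat) * φ.quantum) := by
  have hq := φ.quantum_pos
  have hu := φ.unitRoundoff_pos
  have hr := scaledInput_nonneg (φ := φ) x
  set r := |x| / φ.quantum with hr_def
  have hxr : |x| = r * φ.quantum := by rw [hr_def, div_mul_cancel₀ _ (ne_of_gt hq)]
  have hle : r ≤ φ.maxScaled := by rw [hr_def, div_le_iff₀ hq]; exact hhi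
  have hrm : (2 : ℚ) ^ φ.manBits ≤ r := by rw [hr_def, le_div_iff₀ hq]; exact hlo
  have hfloor : (2 : ℚ) ^ (φ.manBits + φ.shift ⌊r⌋.toNat) ≤ r := by
    rcases Format.shift_floor_dichotomy (φ := φ) hr with hs | hfl
    · rw [hs, add_zero]; exact hrm
    · exact hfl
  set s := φ.shift ⌊r⌋.toNat with hs_def
  set g : ℚ := (2 : ℚ) ^ (φ.manBits + s) with hg
  -- (a) e ≤ r - g
  have hgrep : φ.Representable ((2 ^ φ.manBits + 0) * 2 ^ s) := by
    refine representable_mul_pow (by have := Nat.two_pow_pos φ.manBits; rw [pow_succ]; omega) ?_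
    have : ((2 ^ (φ.manBits + s) : ℕ) : ℚ) ≤ φ.maxScaled := by push_cast; exact le_trans hfloor hle
    have h' : 2 ^ (φ.manBits + s) ≤ φ.maxScaled := by exact_mod_cast this
    simpa [pow_add] using h'
  have ha := Format.abs_sub_rneGrid_le hr hgrep
  have e : (((2 ^ φ.manBits + 0) * 2 ^ s : ℕ) : ℚ) = g := by rw [hg]; push_cast; ring
  rw [e, abs_of_nonneg (by linarith : (0 : ℚ) ≤ r - g)] at ha
  -- (b) e ≤ u g
  have hb := Format.abs_sub_rneGrid_le_half_spacing hr hle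
  have hug : (2 : ℚ) ^ s / 2 = φ.unitRoundoff * g := by
    rw [Format.unitRoundoff_eq, hg]; field_simp; ring
  rw [← hs_def, hug] at hb
  -- the equality, in grid units
  have heq' : |r - (φ.rneGrid r : ℚ)| * (1 + φ.unitRoundoff) = φ.unitRoundoff * r := by
    rw [abs_sub_roundNE, ← hr_def, hxr] at heq
    have : |r - (φ.rneGrid r : ℚ)| = φ.unitRoundoff / (1 + φ.unitRoundoff) * r := by
      have h2 : |r - (φ.rneGrid r : ℚ)| * φ.quantum
          = (φ.unitRoundoff / (1 + φ.unitRoundoff) * r) * φ.quantum := by rw [heq]; ring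
      exact mul_right_cancel₀ (ne_of_gt hq) h2
    rw [this]; field_simp
  -- squeeze: e = u g, hence r = g (1 + u)
  have hmul := mul_le_mul_of_nonneg_left ha hu.le
  have hegal : |r - (φ.rneGrid r : ℚ)| = φ.unitRoundoff * g := by
    apply le_antisymm hb; nlinarith
  have : r = (1 + φ.unitRoundoff) * g := by nlinarith
  rw [hxr, this]; ring

/-- A natural-number equation `a · 2^i = b · 2^j` (as rationals, integer exponents) with `b` odd
forces `b ∣ a`. [folklore] -/
theorem dvd_of_mul_zpow_eq {a b : ℕ} {i j : ℤ} (hb : Odd b)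
    (h : (a : ℚ) * (2 : ℚ) ^ i = (b : ℚ) * (2 : ℚ) ^ j) : b ∣ a := by
  have h2 : (2 : ℚ) ≠ 0 := by norm_num
  rcases le_total i j with hij | hji
  · -- a = b * 2^(j-i)
    obtain ⟨k, hk⟩ := Int.eq_ofNat_of_zero_le (sub_nonneg.mpr hij)
    have : (a : ℚ) = b * 2 ^ k := by
      have e1 : (2 : ℚ) ^ j = 2 ^ i * 2 ^ (k : ℤ) := by rw [← zpow_add₀ h2]; congr 1; omega
      have h' : (a : ℚ) * 2 ^ i = ((b : ℚ) * 2 ^ (k : ℤ)) * 2 ^ i := by rw [h, e1]; ring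
      have := mul_right_cancel₀ (zpow_ne_zero i h2) h'
      rw [zpow_natCast] at this; exact this
    have : a = b * 2 ^ k := by exact_mod_cast this
    exact ⟨2 ^ k, this⟩
  · -- a * 2^(i-j) = b with i - j = k ≥ 0; b odd forces k = 0
    obtain ⟨k, hk⟩ := Int.eq_ofNat_of_zero_le (sub_nonneg.mpr hji)
    have : (a : ℚ) * 2 ^ k = b := by
      have e1 : (2 : ℚ) ^ i = 2 ^ j * 2 ^ (k : ℤ) := by rw [← zpow_add₀ h2]; congr 1; omega
      have h' : ((a : ℚ) * 2 ^ (k : ℤ)) * 2 ^ j = (b : ℚ) * 2 ^ j := by rw [← h, e1]; ring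
      have := mul_right_cancel₀ (zpow_ne_zero j h2) h'
      rw [zpow_natCast] at this; exact this
    have hab : a * 2 ^ k = b := by exact_mod_cast this
    cases k with
    | zero => exact ⟨1, by simp at hab; simp [hab]⟩
    | succ k =>
        exfalso
        have : Even b := ⟨a * 2 ^ k, by rw [← hab]; ring⟩
        exact (Nat.not_even_iff_odd.mpr hb) this

/-- NON-ATTAINMENT FOR SELF-FORMAT PRODUCTS: if `2^p + 1` is prime (`p = m + 1`), no product of
two data of `φ` has relative rounding error `u/(1+u)` in the normal range; the sharp bound is
STRICT there. [folklore] -/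
theorem abs_errMul_lt_sharp_of_prime (hp : Nat.Prime (2 ^ (φ.manBits + 1) + 1))
    (a b : MiniFloat φ) (hlo : 2 ^ φ.manBits * φ.quantum ≤ |a.toRat * b.toRat|)
    (hhi : |a.toRat * b.toRat| ≤ φ.maxRat) :
    |errMul φ a b| < φ.unitRoundoff / (1 + φ.unitRoundoff) * |a.toRat * b.toRat| := by
  refine lt_of_le_of_ne (abs_errMul_le_sharp a b hlo hhi) fun heq => ?_
  unfold errMul at heq; rw [abs_sub_comm] at heq
  have hx := abs_eq_sharp_imp hlo hhi heq
  -- |ab| = n_a n_b 2^(2 qexp)  and  = (2^p + 1) 2^(m+s) 2^qexp / 2^(m+1)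
  have hq := φ.quantum_pos
  set s := φ.shift ⌊|a.toRat * b.toRat| / φ.quantum⌋.toNat with hs
  have hprod : |a.toRat * b.toRat| = ((a.scaledMag * b.scaledMag : ℕ) : ℚ) * (2 : ℚ) ^ (φ.qexp + φ.qexp) := by
    rw [abs_mul, abs_toRat, abs_toRat]; unfold Format.quantum
    rw [zpow_add₀ (by norm_num : (2 : ℚ) ≠ 0)]; push_cast; ring
  have hrhs : (1 + φ.unitRoundoff) * ((2 : ℚ) ^ (φ.manBits + s) * φ.quantum)
      = ((2 ^ (φ.manBits + 1) + 1 : ℕ) : ℚ) * (2 : ℚ) ^ (φ.qexp + s - 1) := by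
    rw [Format.unitRoundoff_eq]; unfold Format.quantum
    have h2 : (2 : ℚ) ≠ 0 := by norm_num
    rw [show φ.qexp + (s : ℤ) - 1 = φ.qexp + ((s : ℤ) - 1) by ring, zpow_add₀ h2,
      zpow_sub₀ h2, zpow_natCast, zpow_one, pow_add]
    push_cast; field_simp; ring
  rw [hprod, hrhs] at hx
  have hdvd := dvd_of_mul_zpow_eq (hp.odd_of_ne_two (by
      have := Nat.one_lt_two_pow (n := φ.manBits + 1) (by omega); omega)) hx
  -- write the significands as k·2^j with k < 2^p; the odd prime divides k_a · k_b
  obtain ⟨-, ka, ja, hka, hka'⟩ := representable_iff.mp a.representable_scaledMag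
  obtain ⟨-, kb, jb, hkb, hkb'⟩ := representable_iff.mp b.representable_scaledMag
  have hfac : a.scaledMag * b.scaledMag = (ka * kb) * 2 ^ (ja + jb) := by rw [hka', hkb']; ring
  have hne : a.scaledMag * b.scaledMag ≠ 0 := by
    intro h0
    have h1 : |a.toRat * b.toRat| = 0 := by rw [hprod, h0]; simp
    rw [h1] at hlo
    have : (0 : ℚ) < 2 ^ φ.manBits * φ.quantum := by positivity
    linarith
  rw [hfac] at hdvd hne
  have hP3 : 3 ≤ 2 ^ (φ.manBits + 1) + 1 := by
    have := Nat.one_lt_two_pow (n := φ.manBits + 1) (by omega); omega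
  have hcop2 : Nat.Coprime (2 ^ (φ.manBits + 1) + 1) 2 :=
    (Nat.Prime.coprime_iff_not_dvd hp).mpr fun h => by
      have := Nat.le_of_dvd (by norm_num) h; omega
  have hcop : Nat.Coprime (2 ^ (φ.manBits + 1) + 1) (2 ^ (ja + jb)) := Nat.Coprime.pow_right _ hcop2
  have hdvd' : 2 ^ (φ.manBits + 1) + 1 ∣ ka * kb := Nat.Coprime.dvd_of_dvd_mul_right hcop hdvd
  have hka0 : ka ≠ 0 := fun h0 => hne (by rw [h0]; simp)
  have hkb0 : kb ≠ 0 := fun h0 => hne (by rw [h0]; simp)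
  rcases (Nat.Prime.dvd_mul hp).mp hdvd' with h | h
  · have := Nat.le_of_dvd (Nat.pos_of_ne_zero hka0) h; omega
  · have := Nat.le_of_dvd (Nat.pos_of_ne_zero hkb0) h; omega

/-- `E2M1` (p = 2, `2^2 + 1 = 5` prime): its product table never attains `u/(1+u) = 1/5` in the
normal range. [folklore] -/
theorem E2M1_errMul_lt_sharp (a b : MiniFloat E2M1) (hlo : 2 ^ E2M1.manBits * E2M1.quantum ≤ |a.toRat * b.toRat|)
    (hhi : |a.toRat * b.toRat| ≤ E2M1.maxRat) :
    |errMul E2M1 a b| < E2M1.unitRoundoff / (1 + E2M1.unitRoundoff) * |a.toRat * b.toRat| :=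
  abs_errMul_lt_sharp_of_prime (by decide) a b hlo hhi

/-- `E4M3` (p = 4, `17` prime): its product table never attains `u/(1+u) = 1/17` in the normal
range (a statement about all `254²` pairs, proved without enumeration). [folklore] -/
theorem E4M3_errMul_lt_sharp (a b : MiniFloat E4M3) (hlo : 2 ^ E4M3.manBits * E4M3.quantum ≤ |a.toRat * b.toRat|)
    (hhi : |a.toRat * b.toRat| ≤ E4M3.maxRat) :
    |errMul E4M3 a b| < E4M3.unitRoundoff / (1 + E4M3.unitRoundoff) * |a.toRat * b.toRat| :=
  abs_errMul_lt_sharp_of_prime (by decide) a b hlo hhi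

/-- `E2M3` (p = 4, `17` prime): never attains `1/17` on products in the normal range. [folklore] -/
theorem E2M3_errMul_lt_sharp (a b : MiniFloat E2M3) (hlo : 2 ^ E2M3.manBits * E2M3.quantum ≤ |a.toRat * b.toRat|)
    (hhi : |a.toRat * b.toRat| ≤ E2M3.maxRat) :
    |errMul E2M3 a b| < E2M3.unitRoundoff / (1 + E2M3.unitRoundoff) * |a.toRat * b.toRat| :=
  abs_errMul_lt_sharp_of_prime (by decide) a b hlo hhi

/-- `bfloat16` (p = 8, `257` prime): its self-format product table never attains
`u/(1+u) = 1/257` in the normal range. [folklore] -/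
theorem BFloat16_errMul_lt_sharp (a b : MiniFloat BFloat16)
    (hlo : 2 ^ BFloat16.manBits * BFloat16.quantum ≤ |a.toRat * b.toRat|)
    (hhi : |a.toRat * b.toRat| ≤ BFloat16.maxRat) :
    |errMul BFloat16 a b| < BFloat16.unitRoundoff / (1 + BFloat16.unitRoundoff) * |a.toRat * b.toRat| :=
  abs_errMul_lt_sharp_of_prime (by norm_num [Format.BFloat16]) a b hlo hhi

end MiniFloat

end Literature.ComputerArithmetic.FloatingPoint
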